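import Summits.BirchSwinnertonDyer.BirchSwinnertonDyer.Theorems.SignedBaseChangeAnticyclotomicEisensteinDivisibilityTwistDeformationDeterminant
import Summits.BirchSwinnertonDyer.BirchSwinnertonDyer.Theorems.SignedBaseChangeAnticyclotomicEisensteinDivisibilityCofreeTateDual
import Literature.NumberTheory.EllipticCurves.AnticyclotomicBigGaloisRep
import HarnessLib

/-!
# Crux 4 `BSDpOnCellC` (stmt-BirchSwinnertonDyer-19034), line «telescope» v13, leaf N2 (W4⁰ fact-free endpoint, local rows
# hLOC1 / hLOC1𝔮 / h0𝔮 of ideator bsd-idea-12 g40's `…TelescopeK2PurityFactFree`): the DETERMINANT form of Greenberg 2010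
# Lemma 5.2.2 for the ONE-VARIABLE co-induced module `𝐃 = A ⊗ Λ_𝒪^*` over a GENERAL coefficient domain `𝒪 ⊇ ℤ_p` and ANY `ρ₀`
# — pure algebra: LOC-core (a twisted-equivariant functional on `𝐃` vanishes) and H⁰-core (a non-zero scalar of `𝒪⟦T⟧` kills the
# fixed vectors) (helper, `--supports stmt-BirchSwinnertonDyer-19034`; closes nothing)

Cell `bsd-eis`, width seat `bsd-line-x2-p2` (prover g22, 2026-08-30; D-0154 KEY row 5). THEOREMS ONLY (no definition, no named fact, no
instance, no notation, no `sorry`). HONEST FRAMING: generic module algebra; nothing about any curve, newform or branch lattice is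
asserted; no stub, no crux, no summit statement is proved; BSD is proved for no curve.

WHY. The fact-free W4⁰ endpoint (ideator g40 #2, `TelescopeK2PurityFactFree.forall_isPseudoNull_XBig_exists_pow_smul_eq_zero_factFree`)
for `X₂ = XBig κ ρ₂ 𝔭̄ ∅` leaves exactly the LOCAL Galois rows for `𝐃 = BigRepModule ℤ_p⟦X⟧ p A₂`: LOC⁽¹⁾ at `𝔭`, `𝔭̄` and
`corank H⁰(K_𝔭̄, 𝐃) = 0` (and cotorsion of `H¹(K_w, 𝐃)` at `w ∣ N`). Greenberg's Lemma 5.2.2 ([Greenberg2010] PDF p. 28: "Suppose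
that `v ∈ Σ` and that the decomposition subgroup of `Γ` for `v` is nontrivial. Then `H⁰(K_v, T*) = 0`") gives both from ONE `σ ∈ Γ_{K_v}`
with `κ(σ) ≠ 1`, by a determinant: `T*` is FREE over the domain `Λ = 𝒪⟦T⟧` and `σ` acts as `κ(σ)⁻¹ ⊗ ρ₀*(σ)`, and a non-constant
group-like element is no eigenvalue of a constant matrix. The two-variable twin (`𝐃 = Ind_{K̃_∞/K}(A)`, `Λ₂`) is cell bsd-ssimc's
`SignedBaseChangeAcDivDeterminant` (bsd-line-sbc-p1-w2 g4); the one-variable `𝒪 = ℤ_p`, corank-2 twin is x1's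
`AcTwistDeformation.bigRep_LOC1_of_quadratic`. THIS FILE is the ONE-variable, GENERAL-`𝒪`, ANY-corank, ANY-`ρ₀` form that the telescope's
`𝒪 = ℤ_p⟦X⟧` needs, over the tree's one-variable Mahler dual datum (`BigRepModule.isDualPairing_seriesToDual`,
`SignedBaseChangeAcDivDualFunctorial.seriesToDual_map_mulVec_of_comp / _of_map`):

* §1 `aeval_binomSeries_ne_zero` — a non-zero `P ∈ 𝒪[X]` does not vanish at the group-like `u = (1+T)^c`, `c ≠ 0` (`𝒪` a domain,
  `ℤ_p ↪ 𝒪`): `P = (X − 1)^k Q`, `Q(1) ≠ 0`, `u ≠ 1` (`BigRepModule.binomSeries_ne_one`), augmentation `T ↦ 0`.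
* §2 **`eq_zero_of_apply_mapRange_binomSeries_smul`** (LOC-core): for `A` `p`-primary with a `C`-valued dual datum free of rank `n` over
  `𝒪`, an invertible `𝒪`-linear `M`, `c ≠ 0` and ANY additive `s : C → C`, every additive `f : 𝐃 → C` with
  `f(M_*((1+T)^c • Φ)) = s(f Φ)` is ZERO (`f = ⟨y, ·⟩`, `(u·Q_M − Q_s) y = 0`, `det = P(u) ≠ 0`, adjugate).
* §3 **`exists_ne_zero_smul_eq_zero_of_mapRange_binomSeries_smul_eq`** (H⁰-core): with a free Pontryagin dual, `λ = det(u·Q_M − 1) ≠ 0`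
  kills every `Φ` with `M_*((1+T)^c • Φ) = Φ` (characters separate points).
* §4 **`bigRep_apply_eq_mapRange_binomSeries_smul`** — the link to the tree's big representation: `bigRep κ ρ g Φ =
  (ρ g)_* ((1+T)^{−κ(g)} • Φ)` (`bigRep_apply_apply` + `BigRepModule.translate_eq_binomSeries_smul`).
* §5 `exists_isDualPairing_characterModule_of_injective` over a GENERAL ring `𝒪` acting on `A` (the `C`-valued dual datum
  `Hom(A, ℚ/ℤ) ≅ Hom(A, C)` of a `p`-primary `A` through injective Prüfer embeddings; verbatim the `ℤ_p`-proof of bsd-line-sbc-p1-w3's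
  `SignedBaseChangeAcDivCofree.exists_isDualPairing_characterModule_of_injective`, which only used the ring in the balance clause).

The Galois wrappers (LOC⁽¹⁾ and `corank H⁰(K_v, 𝐃) = 0` for `descendUnramified S (AnticyclotomicBigGaloisRep κ ρ) hS` from one `σ` with
`κ(σ) ≠ 1`, and the anticyclotomic instantiation at `𝔭`, `𝔭̄`) are this seat's next file.

References: R. Greenberg, *Surjectivity of the global-to-local map defining a Selmer group*, Kyoto J. Math. 50 (2010), §5 (PDF p. 26 L3–17),
Lemma 5.2.2 (PDF p. 28 L20–21) [Greenberg2010]; R. Greenberg, Doc. Math. Extra Vol. Coates (2006), p. 342 L35–41, §4 A Props. 4.1–4.2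
pp. 367–368 [Greenberg2006]; J. Coates–R. Sujatha, *Cyclotomic Fields and Zeta Values* (2006) §3.3 Lemma 3.3.4 [CoatesSujatha2006Cyclotomic].
-/

set_option linter.dupNamespace false
set_option autoImplicit false

noncomputable section

open scoped Classical
open Finset PowerSeries Matrix Polynomial
open Literature.NumberTheory.EllipticCurves Literature.NumberTheory.EllipticCurves.BigRepModule
  Literature.NumberTheory.IwasawaTheory.Greenberg2016 Literature.NumberTheory.IwasawaTheory.Greenberg2006
  Literature.NumberTheory.GaloisRepresentations Literature.NumberTheory.IwasawaTheory

universe u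

namespace Summit.BirchSwinnertonDyer.BirchSwinnertonDyer.Theorems.TelescopeK2BigRepDeterminant

open Summit.BirchSwinnertonDyer.BirchSwinnertonDyer.Theorems
open SignedBaseChangeAcDivDualFunctorial SignedBaseChangeAcDivDeterminant

/-! ## §1 A non-zero constant-coefficient polynomial does not vanish at a non-trivial group-like element of `𝒪⟦T⟧` -/

section Aeval

variable {𝒪 : Type u} [CommRing 𝒪] [IsDomain 𝒪] {p : ℕ} [Fact p.Prime] [Algebra ℤ_[p] 𝒪]

/-- **A non-zero `P ∈ 𝒪[X]` does not vanish at `u = (1+T)^c ∈ 𝒪⟦T⟧` for `c ≠ 0`** (`𝒪` a domain, `ℤ_p ↪ 𝒪`): `P = (X − 1)^k · Q`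
with `Q(1) ≠ 0`; `(u − 1)^k ≠ 0` because `u ≠ 1` (`BigRepModule.binomSeries_ne_one`) and `Q(u) ≠ 0` because its augmentation
(`T ↦ 0`, `u ↦ 1`) is `Q(1)`. One-variable twin of bsd-ssimc's `SignedBaseChangeAcDivGroupLikeAeval.aeval_transSeries_ne_zero`.
[cite: Greenberg2010, Lemma 5.2.2 (PDF p. 28 L20–21), §5 (PDF p. 26 L1–5)] [cite: CoatesSujatha2006Cyclotomic, Lemma 3.3.4 (§3.3 p. 37)] -/
theorem aeval_binomSeries_ne_zero (hinj : Function.Injective (algebraMap ℤ_[p] 𝒪)) {c : ℤ_[p]} (hc : c ≠ 0)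
    {P : 𝒪[X]} (hP : P ≠ 0) : aeval (binomSeries 𝒪 c) P ≠ 0 := by
  set u : PowerSeries 𝒪 := binomSeries 𝒪 c with hu
  obtain ⟨Q, hPQ, hQ⟩ := P.exists_eq_pow_rootMultiplicity_mul_and_not_dvd hP 1
  have hQ1 : Q.eval 1 ≠ 0 := fun h ↦ hQ (dvd_iff_isRoot.mpr h)
  have hev : aeval u P = (u - 1) ^ P.rootMultiplicity 1 * aeval u Q := by
    conv_lhs => rw [hPQ]
    rw [map_mul, map_pow, map_sub, aeval_X, aeval_C, map_one]
  rw [hev]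
  refine mul_ne_zero (pow_ne_zero _ (sub_ne_zero.mpr (binomSeries_ne_one hinj hc))) ?_
  intro h0
  -- the augmentation `ε : 𝒪⟦T⟧ →ₐ[𝒪] 𝒪` (constant coefficient) sends `u ↦ 1`, `Q(u) ↦ Q(1)`
  let ε : PowerSeries 𝒪 →ₐ[𝒪] 𝒪 :=
    AlgHom.mk' (PowerSeries.constantCoeff (R := 𝒪)) fun r x ↦ by
      rw [Algebra.smul_def, map_mul, PowerSeries.algebraMap_apply, Algebra.algebraMap_self, RingHom.id_apply,
        PowerSeries.constantCoeff_C, smul_eq_mul]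
  have hεu : ε u = 1 := constantCoeff_binomSeries (𝒪 := 𝒪) c
  have h1 : ε (aeval u Q) = Q.eval 1 := by
    rw [← aeval_algHom_apply, hεu, coe_aeval_eq_eval]
  rw [h0, map_zero] at h1
  exact hQ1 h1.symm

end Aeval

/-! ## §2 LOC-core: a twisted-equivariant functional on `𝐃 = A ⊗ Λ_𝒪^*` vanishes -/

section Core

variable {𝒪 : Type u} [CommRing 𝒪] [IsDomain 𝒪] {p : ℕ} [Fact p.Prime] [Algebra ℤ_[p] 𝒪]
  {A : Type u} [AddCommGroup A] [Module 𝒪 A]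
  (hinj : Function.Injective (algebraMap ℤ_[p] 𝒪)) (hA : ∀ a : A, ∃ k : ℕ, p ^ k • a = 0)
  {C : Type*} [AddCommGroup C] {Y : Type u} [AddCommGroup Y] [Module 𝒪 Y] {tA : Y →+ (A →+ C)}
  (hY : IsDualPairing 𝒪 A tA) {n : ℕ} (b : Module.Basis (Fin n) 𝒪 Y)

omit [IsDomain 𝒪] in
/-- `Q.map C = Q.map (algebraMap 𝒪 𝒪⟦T⟧)`. [folklore] -/
theorem map_C_eq_map_algebraMap (Q : Matrix (Fin n) (Fin n) 𝒪) :
    Q.map (PowerSeries.C (R := 𝒪)) = Q.map (algebraMap 𝒪 (PowerSeries 𝒪)) := by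
  ext i j
  simp only [Matrix.map_apply, PowerSeries.algebraMap_apply, Algebra.algebraMap_self, RingHom.id_apply]

include hinj hA hY b in
/-- **LOC-core — the determinant form of Greenberg 2010 Lemma 5.2.2 for the ONE-variable co-induced module of ANY corank and ANY
`ρ₀`.** `M` an invertible `𝒪`-linear endomorphism of the `p`-primary `A` (a `C`-valued dual datum of `A` being free of rank `n` over
the domain `𝒪 ⊇ ℤ_p`), `u = (1+T)^c` with `c ≠ 0`, `s` ANY additive endomorphism of `C`: an additive `f : 𝐃 → C` with
`f(M_*(u • Φ)) = s(f Φ)` for all `Φ` is ZERO — `f = ⟨y, ·⟩` on the free `𝒪⟦T⟧`-module `T_A⟦T⟧`, the relation reads `(u·Q_M − Q_s) y = 0`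
for the CONSTANT adjoint matrices, and `det(u·Q_M − Q_s) = P(u) ≠ 0` (leading coefficient `det Q_M ∈ 𝒪ˣ`, §1). For `M = ρ₀(σ̄)`,
`c = −κ(σ)`, `s = σ|_{K̄ˣ}` this is `(T*)^σ = 0`. [cite: Greenberg2010, Lemma 5.2.2 (PDF p. 28 L20–21), §5 (PDF p. 26 L3–17)]
[cite: Greenberg2006, p. 342 L35–36] -/
theorem eq_zero_of_apply_mapRange_binomSeries_smul (M M' : A →ₗ[𝒪] A) (hMM' : ∀ a : A, M (M' a) = a)
    {c : ℤ_[p]} (hc : c ≠ 0) (s : C →+ C) (f : BigRepModule 𝒪 p A →+ C)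
    (hf : ∀ Φ : BigRepModule 𝒪 p A, f (mapRange M (binomSeries 𝒪 c • Φ)) = s (f Φ)) :
    f = 0 := by
  obtain ⟨QM, hQM⟩ := exists_matrix_adjoint_comp hY b M
  obtain ⟨QM', hQM'⟩ := exists_matrix_adjoint_comp hY b M'
  obtain ⟨Qs, hQs⟩ := exists_matrix_adjoint_map hY b s
  have hX := BigRepModule.isDualPairing_seriesToDual (p := p) hA b hY
  obtain ⟨y, rfl⟩ := hX.bijective.2 f
  set u : PowerSeries 𝒪 := binomSeries 𝒪 c with hu
  set B : Matrix (Fin n) (Fin n) (PowerSeries 𝒪) :=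
    u • QM.map (algebraMap 𝒪 _) - Qs.map (algebraMap 𝒪 _) with hB
  -- the linear relation `B y = 0`
  have hrel : B *ᵥ y = 0 := by
    apply hX.injective
    rw [map_zero]
    ext Φ
    rw [hB, Matrix.sub_mulVec, Matrix.smul_mulVec, map_sub, AddMonoidHom.sub_apply, hX.map_smul,
      ← map_C_eq_map_algebraMap, ← map_C_eq_map_algebraMap, seriesToDual_map_mulVec_of_comp hY b M hQM,
      seriesToDual_map_mulVec_of_map hY b s hQs, hf, sub_self, AddMonoidHom.zero_apply]
  -- `det B ≠ 0`
  have hBdet : B.det ≠ 0 := by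
    rw [hB, det_smul_map_sub_map_eq_aeval]
    exact aeval_binomSeries_ne_zero hinj hc
      (det_X_smul_add_ne_zero (isUnit_det_of_adjoint_of_leftInverse hY b hMM' hQM hQM') Qs)
  -- adjugate: `det B • y = 0`, hence `y = 0`
  have hy : B.det • y = 0 := by
    rw [← Matrix.one_mulVec y, ← Matrix.smul_mulVec, ← Matrix.adjugate_mul, ← Matrix.mulVec_mulVec, hrel,
      Matrix.mulVec_zero]
  rw [(smul_eq_zero.mp hy).resolve_left hBdet, map_zero]

/-! ## §3 H⁰-core: a non-zero scalar of `𝒪⟦T⟧` kills the fixed vectors of `Φ ↦ M_*(u • Φ)` -/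

variable {Y₀ : Type u} [AddCommGroup Y₀] [Module 𝒪 Y₀] {t₀ : Y₀ →+ (A →+ AddCircle (1 : ℚ))}
  (hY₀ : IsDualPairing 𝒪 A t₀) {n₀ : ℕ} (b₀ : Module.Basis (Fin n₀) 𝒪 Y₀)

include hinj hA hY₀ b₀ in
/-- **H⁰-core — a NON-ZERO `λ ∈ 𝒪⟦T⟧` kills every `Φ ∈ 𝐃 = A ⊗ Λ_𝒪^*` fixed by `Φ ↦ M_*(u • Φ)`** (`M` invertible, `u = (1+T)^c`,
`c ≠ 0`; `A` `p`-primary with a free Pontryagin dual of rank `n₀`): `λ = det(u·Q_M − 1) = P₀(u)`, `P₀` with leading coefficient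
`det Q_M ∈ 𝒪ˣ`; for a fixed `Φ` and every `z`, `⟨(u·Q_M − 1) z, Φ⟩ = 0`, and with `z = adj · w` this is `⟨w, λ • Φ⟩ = 0` for every
Pontryagin character, so `λ • Φ = 0`. Dual form of `corank H⁰ = 0` in [Greenberg2006] Props. 4.1/4.2.
[cite: Greenberg2010, Lemma 5.2.2 (PDF p. 28 L20–21)] [cite: Greenberg2006, §4 A pp. 367–368 (the terms corank H⁰)] -/
theorem exists_ne_zero_smul_eq_zero_of_mapRange_binomSeries_smul_eq (M M' : A →ₗ[𝒪] A)
    (hMM' : ∀ a : A, M (M' a) = a) {c : ℤ_[p]} (hc : c ≠ 0) :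
    ∃ lam : PowerSeries 𝒪, lam ≠ 0 ∧ ∀ Φ : BigRepModule 𝒪 p A,
      mapRange M (binomSeries 𝒪 c • Φ) = Φ → lam • Φ = 0 := by
  obtain ⟨QM, hQM⟩ := exists_matrix_adjoint_comp hY₀ b₀ M
  obtain ⟨QM', hQM'⟩ := exists_matrix_adjoint_comp hY₀ b₀ M'
  have hX := BigRepModule.isDualPairing_seriesToDual (p := p) hA b₀ hY₀
  set u : PowerSeries 𝒪 := binomSeries 𝒪 c with hu
  set B : Matrix (Fin n₀) (Fin n₀) (PowerSeries 𝒪) :=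
    u • QM.map (algebraMap 𝒪 _) - (1 : Matrix (Fin n₀) (Fin n₀) 𝒪).map (algebraMap 𝒪 _) with hB
  have hBdet : B.det ≠ 0 := by
    rw [hB, det_smul_map_sub_map_eq_aeval]
    exact aeval_binomSeries_ne_zero hinj hc
      (det_X_smul_add_ne_zero (isUnit_det_of_adjoint_of_leftInverse hY₀ b₀ hMM' hQM hQM') 1)
  refine ⟨B.det, hBdet, fun Φ hΦ ↦ ?_⟩
  -- `⟨B z, Φ⟩ = 0` for every `z`
  have hz : ∀ z : Fin n₀ → PowerSeries 𝒪, BigRepModule.seriesToDual t₀ b₀ (B *ᵥ z) Φ = 0 := by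
    intro z
    rw [hB, Matrix.sub_mulVec, Matrix.smul_mulVec, Matrix.map_one (algebraMap 𝒪 _) (map_zero _) (map_one _),
      Matrix.one_mulVec, map_sub, AddMonoidHom.sub_apply, hX.map_smul, ← map_C_eq_map_algebraMap,
      seriesToDual_map_mulVec_of_comp hY₀ b₀ M hQM, hΦ, sub_self]
  -- characters separate points
  refine CharacterModule.eq_zero_of_character_apply fun χ ↦ ?_
  obtain ⟨w, hw⟩ := hX.bijective.2 χ
  have h := hz (B.adjugate *ᵥ w)
  rw [Matrix.mulVec_mulVec, Matrix.mul_adjugate, Matrix.smul_mulVec, Matrix.one_mulVec, hX.map_smul] at h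
  rw [← hw]
  exact h

end Core

/-! ## §4 The link to the big representation: `bigRep κ ρ g = (ρ g)_* ∘ ((1+T)^{−κ(g)} • ·)` -/

section BigRep

variable {𝒪 : Type u} [CommRing 𝒪] {p : ℕ} [Fact p.Prime] [Algebra ℤ_[p] 𝒪] [TopologicalSpace 𝒪]
  {A : Type u} [AddCommGroup A] [Module 𝒪 A] [TopologicalSpace A] [DiscreteTopology A]
  {G : Type*} [Group G] [TopologicalSpace G] [ContinuousMul G] [TopologicalSpace (PowerSeries 𝒪)]

/-- **`g` acts on `𝐃 = A ⊗ Λ_𝒪^*(κ⁻¹)` as `(ρ g)_* ∘ ((1+T)^{−κ(g)} • ·)`**: the matrix part (pointwise `ρ g`, `BigRepModule.mapRange`)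
after the group-like part (translation by `−κ(g)` = multiplication by the binomial series, `BigRepModule.translate_eq_binomSeries_smul`) —
`ρ ⊗ κ⁻¹`. One-variable twin of bsd-ssimc's `SignedBaseChangeAcDivTwistLOC1.twistDeformation_eq_mapRange`.
[cite: Greenberg2006, p. 342 L5 (ρ = ρ₀ ⊗ κ^{-1})] [cite: Castella2018, §2.1 (𝒜 := T ⊗ Λ^*, action ρ ⊗ Ψ^{-1})] -/
theorem bigRep_apply_eq_mapRange_binomSeries_smul (κ : G →ₜ* Multiplicative ℤ_[p]) (ρ : ContinuousRep G 𝒪 A)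
    (g : G) (Φ : BigRepModule 𝒪 p A) :
    bigRep (p := p) κ ρ g Φ = mapRange (ρ g) (binomSeries 𝒪 (-(κ g).toAdd) • Φ) := by
  rw [← translate_eq_binomSeries_smul]
  ext x
  rw [bigRep_apply_apply, mapRange_apply, BigRepModule.translate_apply, sub_eq_add_neg]

end BigRep

/-! ## §5 `C`-valued dual data of a `p`-primary module over a general coefficient ring -/

section Transfer

variable {p : ℕ} [hp : Fact p.Prime] {𝒪 : Type} [CommRing 𝒪]

/-- **`Hom(A, ℚ/ℤ) ≅ Hom(A, C)` as `𝒪`-balanced duals of a `p`-primary `𝒪`-module `A`**, for any group `C` receiving an injective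
`j_C : ℚ_p/ℤ_p → C` with the `p^n`-torsion bound (`C = K̄ˣ`: the Tate dual `Hom(A, μ_{p^∞})`): an additive bijection
`tA : CharacterModule A → Hom(A, C)` with `tA (r • χ) a = tA χ (r • a)` for `r ∈ 𝒪`. Verbatim the `ℤ_p`-proof of bsd-line-sbc-p1-w3's
`SignedBaseChangeAcDivCofree.exists_isDualPairing_characterModule_of_injective` (adapted: the ring enters only the balance clause, through
`CharacterModule.smul_apply`). [cite: Greenberg2006, p. 338 lines 15–16 (`T* = Hom(D, μ_{p^∞})` free of rank `n`)]
[cite: Greenberg2016Selmer, §1 p. 2 L17–35 and §2 p. 5 L15–35 (Pontryagin and Tate duals)] -/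
theorem exists_isDualPairing_characterModule_of_injective {A : Type} [AddCommGroup A] [Module 𝒪 A]
    (hA : ∀ a : A, ∃ k : ℕ, p ^ k • a = 0) {C : Type*} [AddCommGroup C] {jC : QpModZp p →+ C}
    (hjC : Function.Injective jC)
    (hC : ∀ (n : ℕ) (s : Finset C), (∀ c ∈ s, p ^ n • c = 0) → s.card ≤ p ^ n) :
    ∃ tA : CharacterModule A →+ (A →+ C), IsDualPairing 𝒪 A tA := by
  obtain ⟨jQ, hjQ⟩ := QpModZp.exists_injective_character (p := p)
  have hQ := QpModZp.addCircle_torsionBound (p := p)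
  have hmemQ : ∀ (χ : CharacterModule A) (a : A), χ a ∈ jQ.range := fun χ a ↦
    SignedBaseChangeAcDivCofree.apply_mem_range_of_pPrimary hA hjQ hQ (χ : A →+ AddCircle (1 : ℚ)) a
  have hmemC : ∀ (f : A →+ C) (a : A), f a ∈ jC.range := fun f a ↦
    SignedBaseChangeAcDivCofree.apply_mem_range_of_pPrimary hA hjC hC f a
  let eQ : QpModZp p ≃+ jQ.range := AddMonoidHom.ofInjective hjQ
  let eC : QpModZp p ≃+ jC.range := AddMonoidHom.ofInjective hjC
  let Φ : CharacterModule A → (A →+ C) := fun χ ↦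
    jC.comp (eQ.symm.toAddMonoidHom.comp
      (AddMonoidHom.codRestrict (χ : A →+ AddCircle (1 : ℚ)) jQ.range (hmemQ χ)))
  have hΦ : ∀ (χ : CharacterModule A) (a : A) (y : QpModZp p), jQ y = χ a → Φ χ a = jC y := by
    intro χ a y hy
    change jC (eQ.symm ⟨χ a, hmemQ χ a⟩) = jC y
    congr 1
    apply hjQ
    rw [AddMonoidHom.apply_ofInjective_symm hjQ]
    exact hy.symm
  have hex : ∀ (χ : CharacterModule A) (a : A), ∃ y : QpModZp p, jQ y = χ a := fun χ a ↦ by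
    obtain ⟨y, hy⟩ := hmemQ χ a
    exact ⟨y, hy⟩
  have h0 : Φ 0 = 0 := by
    ext a
    rw [hΦ 0 a 0 (by rw [map_zero]; rfl), map_zero, AddMonoidHom.zero_apply]
  have hadd : ∀ χ ψ : CharacterModule A, Φ (χ + ψ) = Φ χ + Φ ψ := by
    intro χ ψ
    ext a
    obtain ⟨y₁, hy₁⟩ := hex χ a
    obtain ⟨y₂, hy₂⟩ := hex ψ a
    rw [AddMonoidHom.add_apply, hΦ χ a y₁ hy₁, hΦ ψ a y₂ hy₂, ← map_add,
      hΦ (χ + ψ) a (y₁ + y₂) (by rw [map_add, hy₁, hy₂]; rfl)]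
  let T : CharacterModule A →+ (A →+ C) := { toFun := Φ, map_zero' := h0, map_add' := hadd }
  have hT : ∀ χ, T χ = Φ χ := fun _ ↦ rfl
  refine ⟨T, ⟨?_, ?_⟩, ?_⟩
  · intro χ ψ h
    apply DFunLike.ext
    intro a
    obtain ⟨y₁, hy₁⟩ := hex χ a
    obtain ⟨y₂, hy₂⟩ := hex ψ a
    have h' : Φ χ a = Φ ψ a := by rw [← hT, ← hT, h]
    rw [hΦ χ a y₁ hy₁, hΦ ψ a y₂ hy₂] at h'
    rw [← hy₁, ← hy₂, hjC h']
  · intro f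
    let χ : CharacterModule A :=
      jQ.comp (eC.symm.toAddMonoidHom.comp (AddMonoidHom.codRestrict f jC.range (hmemC f)))
    refine ⟨χ, ?_⟩
    ext a
    rw [hT]
    rw [hΦ χ a (eC.symm ⟨f a, hmemC f a⟩) rfl, AddMonoidHom.apply_ofInjective_symm hjC]
  · intro r χ a
    rw [hT, hT]
    obtain ⟨y, hy⟩ := hex χ (r • a)
    rw [hΦ χ (r • a) y hy, hΦ (r • χ) a y (by rw [hy, CharacterModule.smul_apply])]

/-- **A `p`-primary COFREE `𝒪`-module has, for every Prüfer target `C`, a `C`-valued dual datum with a finite `𝒪`-basis** (and a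
Pontryagin one): `IsCofree 𝒪 A` makes the character module finite free over `𝒪` (read on the datum `Hom(A, ℚ/ℤ)` itself,
`Greenberg2016.isDualPairing_characterModule`), and the previous theorem transfers it to `C`. The shape of the hypotheses `hY, b` /
`hY₀, b₀` of §2–§3. [cite: Greenberg2006, p. 338 lines 15–16, p. 342 L4–11] -/
theorem exists_dual_bases_of_isCofree {A : Type} [AddCommGroup A] [Module 𝒪 A]
    (hA : ∀ a : A, ∃ k : ℕ, p ^ k • a = 0) (hcof : IsCofree 𝒪 A)
    {C : Type*} [AddCommGroup C] {jC : QpModZp p →+ C} (hjC : Function.Injective jC)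
    (hC : ∀ (n : ℕ) (s : Finset C), (∀ c ∈ s, p ^ n • c = 0) → s.card ≤ p ^ n) :
    ∃ (tA : CharacterModule A →+ (A →+ C)) (_ : IsDualPairing 𝒪 A tA) (n : ℕ),
      Nonempty (Module.Basis (Fin n) 𝒪 (CharacterModule A)) := by
  obtain ⟨tA, htA⟩ := exists_isDualPairing_characterModule_of_injective (𝒪 := 𝒪) hA hjC hC
  obtain ⟨hfree, hfin⟩ := hcof (CharacterModule A) (AddMonoidHom.id _) (isDualPairing_characterModule 𝒪 A)
  haveI := hfree
  haveI := hfin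
  let b := Module.Free.chooseBasis 𝒪 (CharacterModule A)
  exact ⟨tA, htA, Fintype.card (Module.Free.ChooseBasisIndex 𝒪 (CharacterModule A)), ⟨b.reindex (Fintype.equivFin _)⟩⟩

end Transfer

end Summit.BirchSwinnertonDyer.BirchSwinnertonDyer.Theorems.TelescopeK2BigRepDeterminant

end
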